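import Literature.MathematicalPhysics.KineticTheory.HardSphereEulerLLN
import Summits.AtomisticToContinuum.HydrodynamicLimit.Theorems.PolynomialCompression.Negative.PdeForm
import HarnessLib

/-!
# σ-uniform density contrast of the Euler data (stub `densityContrast`)

Supporting file of the line `Sketch` (card `adiabat-pricing-of-the-ceiling`) for the crux
`AprioriBounds` (stmt-AtomisticToContinuum-14827), proving the registered stub
`stub_densityContrast` of the lead's skeleton VERBATIM: if a classical hard-sphere Euler solution
`(ρ, u, θ)` on `[0, T)`, `T > 0`, is tied to the local Gibbs laws with profiles `(a₀, u₀, θ₀)` by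
the `t = 0` clause `TendstoHydroFieldsAt … ρ u θ 0` (`HardSphereEuler.lean`) through ONE flow family
`Φ`, and `σ < σ₀(a₀, θ₀, u₀)`, then the initial density has contrast
`ρ(0, x) ≤ R · ρ(0, y)` with `R = 4(2e+1) M / β_min` depending on the activity `a₀` ONLY
(`β = a₀ / ∫a₀ = (profileOf a₀).β`, `M = sup β`, `β_min = min β`), uniformly in `σ < σ₀`.

## Proof

Low-density statics of the canonical hard-sphere one-point function, all LANDED:
* DATA PINNING of the density (`DenseExcursionAtTimeZero.density_zero_eq_rhoLim`,
  `Theorems/DenseExcursion/Negative/AtTimeZero.lean`): below a threshold `σ₁ ≤ 1/2` the tie through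
  any flow family identifies the continuous time-`0` slice `ρ(0, ·)` (continuity from the classical
  solution at `0 ∈ [0, T)`) with the tree's explicit cluster series `rhoLim (profileOf a₀) σ` of the
  PROVED law of large numbers (`HardSphereEulerLLN.lean`; uniqueness of limits in probability under
  the probability measures `localGibbsMeasure`);
* the σ-UNIFORM CEILING `rhoLim < (2e+1) M` (`DenseExcursionAtTimeZero.rhoLim_lt`);
* the σ-UNIFORM FLOOR `rhoLim > β_min / 4`: `rhoLim ≥ R_σ β − 2eMθ/(1−θ)` (`SmallDensity.rhoLim_ge`)
  with `R_σ ≥ 1/2` (`SmallDensity.ratioLimit_mem`) and the smallness margin `4eMθ/(1−θ) < β_min / 2`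
  for `σ` below the threshold of `exists_smallDensity (profileOf a₀) (β_min / 2)`.
`σ₀` is the minimum of the two thresholds; `R` is chosen before `σ`.

No new definitions, no named facts, no helper lemmas; axioms `propext`, `Classical.choice`,
`Quot.sound`.
-/

noncomputable section

open MeasureTheory Filter Set Topology
open scoped ENNReal ContDiff

namespace Summit.AtomisticToContinuum.HydrodynamicLimit.Theorems.AdiabatCeiling

open Literature.MathematicalPhysics.KineticTheory Literature.Analysis.FluidPDE
open Literature.Analysis.FunctionSpaces
open DenseExcursionAtTimeZero (density_zero_eq_rhoLim rhoLim_lt)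

/-- STUB `densityContrast` of the line `Sketch` (crux `AprioriBounds`,
stmt-AtomisticToContinuum-14827): statics of the canonical hard-sphere ensemble at low packing.
For `σ < σ₀(a₀, θ₀, u₀)` there is `R = 4(2e+1)·sup β / min β` (`β = a₀/∫a₀`; `R` depends on `a₀`
only and is chosen BEFORE `σ`) such that the Euler datum `ρ(0, ·)` identified by the `t = 0` LLN
clause has contrast `ρ(0, x) ≤ R ρ(0, y)`: the clause pins `ρ(0, ·) = rhoLim (profileOf a₀) σ`
(`DenseExcursionAtTimeZero.density_zero_eq_rhoLim`), and the cluster series obeys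
`min β / 4 < rhoLim < (2e+1) sup β` uniformly in small `σ` (`SmallDensity.rhoLim_ge`,
`SmallDensity.ratioLimit_mem`, `exists_smallDensity`, `DenseExcursionAtTimeZero.rhoLim_lt`). -/
theorem stub_densityContrast :
    ∀ (a₀ θ₀ : T3 → ℝ) (u₀ : T3 → V3), Continuous a₀ → Continuous θ₀ → Continuous u₀ →
      (∀ x, 0 < a₀ x) → (∀ x, 0 < θ₀ x) →
      ∃ σ₀ : ℝ, 0 < σ₀ ∧ ∃ R : ℝ, 0 < R ∧ ∀ σ : ℝ, 0 < σ → σ < σ₀ →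
        ∀ (T : ℝ) (ρ θ : ℝ → T3 → ℝ) (u : ℝ → T3 → V3), IsHardSphereEulerSolution σ T ρ u θ → 0 < T →
        ∀ Φ : (N : ℕ) → HardSphereFlow (Torus.geometry (Fin 3)) (hsDiameter σ N) (N + 1),
          TendstoHydroFieldsAt (fun N => localGibbsLaw σ a₀ u₀ θ₀ N (Φ N)) Φ ρ u θ 0 →
          ∀ x y : T3, ρ 0 x ≤ R * ρ 0 y := by
  intro a₀ θ₀ u₀ ha hθ hu ha0 hθ0
  set P := profileOf a₀ ha ha0 with hP
  -- the floor of the profile on the compact torus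
  obtain ⟨x₀, -, hx₀⟩ := isCompact_univ.exists_isMinOn univ_nonempty P.continuous.continuousOn
  have hβmin : ∀ y, P.β x₀ ≤ P.β y := fun y => (isMinOn_iff.mp hx₀) y (mem_univ y)
  have hβ0 : 0 < P.β x₀ := P.pos x₀
  have hM : 0 < P.M := P.M_pos
  -- thresholds: data pinning (`σ₁ ≤ 1/2`) and the statics margin `4eMθ/(1-θ) < β_min / 2`
  obtain ⟨σ₁, hσ₁, -, G⟩ := density_zero_eq_rhoLim ha hθ hu ha0 hθ0
  obtain ⟨σc, hσc, Hc⟩ := exists_smallDensity P (half_pos hβ0)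
  set K := (2 * Real.exp 1 + 1) * P.M with hK
  have hK0 : 0 < K := by positivity
  refine ⟨min σ₁ σc, lt_min hσ₁ hσc, 4 * K / P.β x₀, by positivity, fun σ hσ hσlt T ρ θ u hsol hT Φ hTie x y => ?_⟩
  have hσ1 : σ < σ₁ := hσlt.trans_le (min_le_left _ _)
  have hσc' : σ < σc := hσlt.trans_le (min_le_right _ _)
  obtain ⟨-, G'⟩ := G σ hσ hσ1
  obtain ⟨hS, hmargin⟩ := Hc σ hσ hσc'
  -- pin the datum
  have h0 : (0 : ℝ) ∈ Ico 0 T := ⟨le_rfl, hT⟩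
  have hρ0 : ρ 0 = rhoLim P σ :=
    G' ρ θ u Φ (hsol.smooth_density.isSmooth_slice h0).continuous hTie
  -- ceiling at `x`, floor at `y`
  have hup : ρ 0 x < K := by rw [hρ0]; exact rhoLim_lt hS x
  have hlow : P.β x₀ / 4 ≤ ρ 0 y := by
    rw [hρ0]
    have h1 := hS.rhoLim_ge y
    have hR := hS.ratioLimit_mem.1
    have hβy := hβmin y
    have h2 : P.β x₀ / 2 ≤ ratioLimit P σ * P.β y := by nlinarith [(P.pos y).le]
    have h4 : 2 * Real.exp 1 * P.M * geomRatio P σ / (1 - geomRatio P σ) < P.β x₀ / 4 := by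
      have e : 4 * Real.exp 1 * P.M * geomRatio P σ / (1 - geomRatio P σ) =
          2 * (2 * Real.exp 1 * P.M * geomRatio P σ / (1 - geomRatio P σ)) := by ring
      rw [e] at hmargin
      linarith
    linarith
  have hkey : K ≤ 4 * K / P.β x₀ * ρ 0 y :=
    calc K = 4 * K / P.β x₀ * (P.β x₀ / 4) := by field_simp
      _ ≤ 4 * K / P.β x₀ * ρ 0 y := mul_le_mul_of_nonneg_left hlow (by positivity)
  exact hup.le.trans hkey

end Summit.AtomisticToContinuum.HydrodynamicLimit.Theorems.AdiabatCeiling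

end
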